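import Mathlib
import HarnessLib
import Summits.HubbardSuperconductivity.HubbardSuperconductivity.Theorems.KLProgrammeKLRegimeFrameShellCount
import Summits.HubbardSuperconductivity.HubbardSuperconductivity.Theorems.KLProgrammeKLRegimeTwoVolumeTowerDefs
import Literature.MathematicalPhysics.QuantumLattice.HubbardMatsubaraTwoCutoffGram

/-!
# Route `KLProgramme` — crux K3, VL child `KLRegimeVolumeLimitV17F2` (stmt-HubbardSuperconductivity-20440), blueprint v5 M5: THE GRAM CONSTANT OF THE FIRST
# STEP COVARIANCE `klStepCov V M β μ K 0` AT ANY ADMISSIBLE FRAME, EVERY VOLUME (seat hubbard-kl-k3c4-p1 g14; `--supports` 20440)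

The field `TowerVolumeDataT.cov 0` / `TowerCrossData.cov 0` (`…TowerSpineDefs`, `…TowerTruncDefs`) asks for `ScaleCovData (klStepCov V M β μ K 0) …`, whose
`gram` component is a replica-Gram bound of the FIRST step covariance `klStepCov V M β μ K 0 = S(F̃_0[K])ᵀ · C^K_{(Λ_2,Λ_1]} · S(F̃_0[K])`.  The engine's
sector-resolved Gram doors (`gram_entry_klStepCov_klEng`) start at `k = 1` (located «SCALE-0-STEPCOV», p3 g12 `…TowerStepCovZero`).  At `k = 0` no sector
resolution is needed: k3c4-p1 g2's threshold-free slice Gram bound `KLRegimeSplit.isGramBoundedR_sliceCT_scale_of_frameOK` (every `L ≥ 1`, multipliers of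
norm `≤ 1`, any admissible frame) applies verbatim to the fat family `F̃_0` (`norm_bgmFatMultiplier_le_one`), and its constant is dominated by a VOLUME-FREE one:

* `stepCovZero_gramConst_le` — `‖(βV²)⁻¹‖²·(Λ_1β/π+3)(1793Λ_1V²+704V)·(8βV²/Λ_1) ≤ 8(Λ_1β/π+3)(1793Λ_1+704)/(βΛ_1)` for `V ≥ 1`;
* **`isGramBoundedR_klStepCov_zero_of_frameOK`** — `IsGramBoundedR (klStepCov V M β μ K 0) √(8(Λ_1β/π+3)(1793Λ_1+704)/(βΛ_1))` for every admissible
  frame `FrameOK R U N μ K`, every `β > 0`, every volume `V ≥ 1` and cutoff `M ≥ 1` (`Λ_1 = klScale klE0 1 = 1/128`).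

Proofs only; no definition; nothing asserts any stub, K3, VL or superconductivity. [cite: BenfattoGiulianiMastropietro2006, §2.8 (2.80)]
-/

noncomputable section

namespace Summit.HubbardSuperconductivity.HubbardSuperconductivity.Theorems.TwoVolumeSource

set_option linter.dupNamespace false -- summit = problem name (single-conjunct summit), D-0017

open Finset Literature.MathematicalPhysics.QuantumLattice GrassmannAlgebra Literature.Probability.LatticeModels
open Literature.MathematicalPhysics.QuantumLattice.FermiRG
open Summit.HubbardSuperconductivity.HubbardSuperconductivity.Theorems.KLProgrammeLegKernels
open Summit.HubbardSuperconductivity.HubbardSuperconductivity.Theorems.KLRegimeSplit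
open Summit.HubbardSuperconductivity.HubbardSuperconductivity.Theorems.EngineV8
open Summit.HubbardSuperconductivity.HubbardSuperconductivity.Theorems.TwoVolumeDefect

/-- **The slice Gram constant at scale `1` is dominated by a volume-free number** (`V ≥ 1`, `0 < β`). [folklore] -/
theorem stepCovZero_gramConst_le {V : ℕ} (hV : 1 ≤ V) {β : ℝ} (hβ : 0 < β) :
    ‖((1 / (β * (V : ℝ) ^ 2) : ℝ) : ℂ)‖ ^ 2 *
        (((klScale klE0 1 * β / Real.pi + 3) * (1793 * klScale klE0 1 * (V : ℝ) ^ 2 + 704 * V)) * (8 * (β * (V : ℝ) ^ 2) / klScale klE0 1)) ≤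
      8 * (klScale klE0 1 * β / Real.pi + 3) * (1793 * klScale klE0 1 + 704) / (β * klScale klE0 1) := by
  have hΛ : 0 < klScale klE0 1 := klth_klScale_pos 1
  have hV1 : (1 : ℝ) ≤ V := by exact_mod_cast hV
  have hV0 : (0 : ℝ) < V := by linarith
  have hA : 0 ≤ klScale klE0 1 * β / Real.pi + 3 := by positivity
  have hnorm : ‖((1 / (β * (V : ℝ) ^ 2) : ℝ) : ℂ)‖ = 1 / (β * (V : ℝ) ^ 2) := by
    rw [Complex.norm_real, Real.norm_of_nonneg (by positivity)]
  rw [hnorm]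
  -- the left side is `8·A·(1793Λ₁ + 704/V)/(βΛ₁)`
  have hid : (1 / (β * (V : ℝ) ^ 2)) ^ 2 *
      (((klScale klE0 1 * β / Real.pi + 3) * (1793 * klScale klE0 1 * (V : ℝ) ^ 2 + 704 * V)) * (8 * (β * (V : ℝ) ^ 2) / klScale klE0 1)) =
      8 * (klScale klE0 1 * β / Real.pi + 3) * (1793 * klScale klE0 1 + 704 / V) / (β * klScale klE0 1) := by
    field_simp
  rw [hid]
  have h704 : 704 / (V : ℝ) ≤ 704 := div_le_self (by norm_num) hV1
  have hnum : 8 * (klScale klE0 1 * β / Real.pi + 3) * (1793 * klScale klE0 1 + 704 / V) ≤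
      8 * (klScale klE0 1 * β / Real.pi + 3) * (1793 * klScale klE0 1 + 704) :=
    mul_le_mul_of_nonneg_left (by linarith) (by positivity)
  exact div_le_div_of_nonneg_right hnum (by positivity)

/-- **THE FIRST STEP COVARIANCE IS REPLICA-GRAM BOUNDED WITH A VOLUME-FREE CONSTANT** (see the module docstring): the `gram` field of
`ScaleCovData (klStepCov V M β μ K 0) …` at any admissible frame, every `β > 0`, every volume and cutoff.
[cite: BenfattoGiulianiMastropietro2006, §2.8 (2.80)] -/
theorem isGramBoundedR_klStepCov_zero_of_frameOK {V M : ℕ} [NeZero V] [NeZero M] {R : RenConsts} {U : ℝ} {N : ℕ} {μ : ℝ}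
    {K : TrigPolyC4v} (hK : FrameOK R U N μ K) {β : ℝ} (hβ : 0 < β) :
    IsGramBoundedR (klStepCov V M β μ K 0)
      (Real.sqrt (8 * (klScale klE0 1 * β / Real.pi + 3) * (1793 * klScale klE0 1 + 704) / (β * klScale klE0 1))) := by
  have hV : 1 ≤ V := Nat.pos_of_ne_zero (NeZero.ne V)
  have h := isGramBoundedR_sliceCT_scale_of_frameOK (L := V) (M := M) hK hβ 1 (bgmFatMultiplier V M klE0 β (nambuXiCT V μ K) 0)
    (fun ω k => norm_bgmFatMultiplier_le_one klE0 β (nambuXiCT V μ K) 0 ω k)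
  -- `klStepCov … 0` is that pullback of the slice `(Λ_2, Λ_1]`
  have hC : klStepCov V M β μ K 0 = (sectorSubMatrix V M β (bgmFatMultiplier V M klE0 β (nambuXiCT V μ K) 0)).transpose *
      hubbardCovSliceCT V M β μ 0 K (klScale klE0 (1 + 1)) (klScale klE0 1) * sectorSubMatrix V M β (bgmFatMultiplier V M klE0 β (nambuXiCT V μ K) 0) := rfl
  rw [hC]
  exact IsGramBoundedR.mono h (Real.sqrt_nonneg _) (Real.sqrt_le_sqrt (stepCovZero_gramConst_le hV hβ))

end Summit.HubbardSuperconductivity.HubbardSuperconductivity.Theorems.TwoVolumeSource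

end
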